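import Summits.ValiantsHypothesis.ValiantsHypothesis.Theorems.PolyaContinuedMonotoneCoverHardOneLevel

/-!
# Crux `MonotoneCoverHard` (stmt-ValiantsHypothesis-7421), width line — **TOKENS MUST ROTATE**: no
label-bijective Pfaffian cover of `per_n` (`n ≥ 3`) has a matching-independent set of token rows

Third structural non-Pfaffian theorem of the algebraic route (val-width-7421-p3 g0; sequel of
`…OneLevel.lean` (one variable level impossible) and `…HardLanes.lean` (three hard lanes impossible)).
Call a row of a cover a TOKEN of a weight-nonzero perfect matching `τ` if its `τ`-edge is variable-
labelled.  `no_permanentTokens_pfaffian_cover`: in a label-bijective Pfaffian cover `(m, E, a)` of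
`per_n`, `n ≥ 3`, it is impossible that every row which is a token of SOME weight-nonzero matching is a
token of ALL of them (`hperm`).  Equivalently: the variable edges cannot be confined to a fixed set of
`n` rows — some row must carry a variable edge in one matching and a constant edge in another.  (The
trivial cover `K_{n,n}` and every "row-register" design violate this and are indeed non-Pfaffian;
Grenet-type covers rotate their token.)

Proof.  Pólya signing ⇒ `per_n = det M` (`det_signedLabel_eq_perPoly`).  Under `hperm` the rows split
into `A` (always tokens: entries of `M` homogeneous linear) and `B` (never tokens: entries CONSTANT),
`|A| = n`.  After permuting columns by a weight-nonzero `τ₀`, the constant block `M₁[B,B]` is unimodular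
(`det_idleBlock_eq_prod`: a contributing permutation would give a second matching with the same variable
edges), and ONE Schur step with this constant pivot (`det_eq_C_mul_det_schur`, `totalDegree_schur_le`)
yields `per_n = c · det L` with `L` an `n × n` matrix of affine-linear forms — an affine determinantal
representation of size `n`, against Mignon–Ressayre (`n² ≤ 2n`).  By the symmetry `x ↦ xᵀ` of the
permanent the same holds for columns (not typed here).  VP ≠ VNP is not moved; `MonotoneCoverHard`
stays open (the width bet concerns how FAST tokens must rotate, not whether).  No definitions.
-/

namespace Summit.ValiantsHypothesis.ValiantsHypothesis.Theorems.PolyaContinuedMonotoneCoverHard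

-- summit = sub-problem name (single-conjunct summit, D-0017 layout), so the namespace repeats it
set_option linter.dupNamespace false

open scoped Classical
open Finset
open Literature.Combinatorics.SimpleGraph (IsPolyaSigning)
open Literature.Computability.AlgebraicComplexity (HasDetRepr sq_le_two_mul_of_hasDetRepr_perPoly)
open Summit.ValiantsHypothesis.ValiantsHypothesis.Theorems.PolyaContinued.MonotoneCoverHardRectangle
  (exists_labels aeval_permanent_cover perPoly_eq_sum_monomial label_bijection pexp_injective)

/-- **Tokens must rotate.**  No label-bijective Pfaffian cover of `per_n`, `n ≥ 3`, has the property
that a row carrying a variable edge in one weight-nonzero perfect matching carries one in every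
weight-nonzero perfect matching. -/
theorem no_permanentTokens_pfaffian_cover (n m : ℕ) (hn : 3 ≤ n) (E : Finset (Fin m × Fin m))
    (a : Fin m × Fin m → MvPolynomial (Fin n × Fin n) ℂ)
    (hsig : ∃ s : Fin m × Fin m → ℂ, (∀ e, s e = 1 ∨ s e = -1) ∧
      (Matrix.of fun i j => if (i, j) ∈ E then MvPolynomial.C (s (i, j)) * MvPolynomial.X (i, j)
          else 0 : Matrix (Fin m) (Fin m) (MvPolynomial (Fin m × Fin m) ℂ)).det =
        (Matrix.of fun i j => if (i, j) ∈ E then MvPolynomial.X (i, j) else 0 :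
          Matrix (Fin m) (Fin m) (MvPolynomial (Fin m × Fin m) ℂ)).permanent)
    (ha : ∀ e, (∃ j, a e = MvPolynomial.X j) ∨ a e = 0 ∨ a e = 1)
    (hper : Literature.Computability.AlgebraicComplexity.perPoly (Fin n) ℂ =
      MvPolynomial.aeval a (Matrix.of fun i j => if (i, j) ∈ E then MvPolynomial.X (i, j) else 0 :
          Matrix (Fin m) (Fin m) (MvPolynomial (Fin m × Fin m) ℂ)).permanent)
    (hperm : ∀ τ τ' : Equiv.Perm (Fin m), (∀ i, (i, τ i) ∈ E ∧ a (i, τ i) ≠ 0) →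
      (∀ i, (i, τ' i) ∈ E ∧ a (i, τ' i) ≠ 0) → ∀ i,
      (∃ k, a (i, τ i) = MvPolynomial.X k) → ∃ k, a (i, τ' i) = MvPolynomial.X k) : False := by
  obtain ⟨n, rfl⟩ : ∃ k, n = k + 3 := ⟨n - 3, by omega⟩
  clear hn
  -- Pólya signing, signed label matrix, `det M = per`
  obtain ⟨s, hs⟩ := exists_polyaSigning_of_symbolic E hsig
  obtain ⟨M, hM⟩ : ∃ M : Matrix (Fin m) (Fin m) (MvPolynomial (Fin (n + 3) × Fin (n + 3)) ℂ),
      ∀ i j, M i j = if ∃ τ : Equiv.Perm (Fin m), (∀ k, (k, τ k) ∈ E ∧ a (k, τ k) ≠ 0) ∧ τ i = j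
        then MvPolynomial.C ((s (i, j) : ℤ) : ℂ) * a (i, j) else 0 :=
    ⟨fun i j => if ∃ τ : Equiv.Perm (Fin m), (∀ k, (k, τ k) ∈ E ∧ a (k, τ k) ≠ 0) ∧ τ i = j
        then MvPolynomial.C ((s (i, j) : ℤ) : ℂ) * a (i, j) else 0, fun _ _ => rfl⟩
  have hdetM := det_signedLabel_eq_perPoly E a hper s hs M hM
  -- a weight-nonzero perfect matching `τ₀`
  obtain ⟨τ₀, hτ₀⟩ : ∃ τ₀ : Equiv.Perm (Fin m), ∀ i, (i, τ₀ i) ∈ E ∧ a (i, τ₀ i) ≠ 0 := by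
    obtain ⟨δ, hδ, -, -⟩ := exists_labels a ha
    set G := univ.filter fun τ : Equiv.Perm (Fin m) => ∀ i, (i, τ i) ∈ E ∧ a (i, τ i) ≠ 0 with hG
    have hsum : ∑ τ ∈ G, MvPolynomial.monomial (∑ i, δ (i, τ i)) (1 : ℂ) =
        ∑ σ : Equiv.Perm (Fin (n + 3)),
          MvPolynomial.monomial (∑ k, Finsupp.single (k, σ k) 1) (1 : ℂ) := by
      rw [← aeval_permanent_cover E a δ hδ G hG, ← hper, perPoly_eq_sum_monomial]
    obtain ⟨-, -, hsurj⟩ := label_bijection G (fun τ => ∑ i, δ (i, τ i))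
      (fun σ : Equiv.Perm (Fin (n + 3)) => ∑ k, Finsupp.single (k, σ k) (1 : ℕ)) pexp_injective hsum
    obtain ⟨τ, hτG, -⟩ := hsurj 1
    rw [hG] at hτG
    exact ⟨τ, (mem_filter.1 hτG).2⟩
  -- used edges of a non-token row of `τ₀` are never variable
  have hK1 : ∀ i j, (∃ τ : Equiv.Perm (Fin m), (∀ k, (k, τ k) ∈ E ∧ a (k, τ k) ≠ 0) ∧ τ i = j) →
      ((i, j) ∈ E ∧ a (i, j) ≠ 0) ∧
      ((¬ ∃ k, a (i, τ₀ i) = MvPolynomial.X k) → ¬ ∃ k, a (i, j) = MvPolynomial.X k) := by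
    rintro i j ⟨τ, hτ, rfl⟩
    exact ⟨hτ i, fun hnv hv => hnv (hperm τ τ₀ hτ hτ₀ i hv)⟩
  have hK2 : ∀ e, a e ≠ 0 → (¬ ∃ k, a e = MvPolynomial.X k) → a e = 1 := by
    intro e h1 h2
    rcases ha e with h | h | h
    · exact absurd h h2
    · exact absurd h h1
    · exact h
  have hunit : ∀ e, ((s e : ℤ) : ℂ) ≠ 0 := fun e => by
    rcases Int.units_eq_one_or (s e) with h | h <;> simp [h]
  -- the column-permuted matrix `M₁ = M ∘ τ₀` and its constant companion `Sf`
  set M₁ : Matrix (Fin m) (Fin m) (MvPolynomial (Fin (n + 3) × Fin (n + 3)) ℂ) :=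
    M.submatrix id τ₀ with hM₁def
  have hM₁ : ∀ i i', M₁ i i' =
      if ∃ τ : Equiv.Perm (Fin m), (∀ k, (k, τ k) ∈ E ∧ a (k, τ k) ≠ 0) ∧ τ i = τ₀ i'
      then MvPolynomial.C ((s (i, τ₀ i') : ℤ) : ℂ) * a (i, τ₀ i') else 0 := fun i i' => by
    rw [hM₁def, Matrix.submatrix_apply]
    exact hM i (τ₀ i')
  have hdet₁ : M₁.det = ((Equiv.Perm.sign τ₀ : ℤ) : MvPolynomial (Fin (n + 3) × Fin (n + 3)) ℂ) *
      M.det := Matrix.det_permute' τ₀ M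
  obtain ⟨Sf, hSf⟩ : ∃ Sf : Matrix (Fin m) (Fin m) ℂ, ∀ i i', Sf i i' =
      if ∃ τ : Equiv.Perm (Fin m), (∀ k, (k, τ k) ∈ E ∧ a (k, τ k) ≠ 0) ∧ τ i = τ₀ i'
      then ((s (i, τ₀ i') : ℤ) : ℂ) else 0 :=
    ⟨fun i i' => if ∃ τ : Equiv.Perm (Fin m), (∀ k, (k, τ k) ∈ E ∧ a (k, τ k) ≠ 0) ∧ τ i = τ₀ i'
      then ((s (i, τ₀ i') : ℤ) : ℂ) else 0, fun _ _ => rfl⟩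
  -- rows that are not tokens of `τ₀` are constant
  have hZrow : ∀ i i', (¬ ∃ k, a (i, τ₀ i) = MvPolynomial.X k) →
      M₁ i i' = MvPolynomial.C (Sf i i') := by
    intro i i' hi
    rw [hM₁, hSf]
    split_ifs with hu
    · rw [hK2 _ (hK1 _ _ hu).1.2 ((hK1 _ _ hu).2 hi), mul_one]
    · exact MvPolynomial.C_0.symm
  -- all entries are affine-linear
  have hdeg : ∀ i i', (M₁ i i').totalDegree ≤ 1 := by
    intro i i'
    rw [hM₁]
    split_ifs with hu
    · by_cases hv : ∃ k, a (i, τ₀ i') = MvPolynomial.X k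
      · obtain ⟨k, hk⟩ := hv
        rw [hk]
        calc (MvPolynomial.C ((s (i, τ₀ i') : ℤ) : ℂ) * MvPolynomial.X k).totalDegree
            ≤ (MvPolynomial.C ((s (i, τ₀ i') : ℤ) : ℂ) :
                MvPolynomial (Fin (n + 3) × Fin (n + 3)) ℂ).totalDegree +
              (MvPolynomial.X k : MvPolynomial (Fin (n + 3) × Fin (n + 3)) ℂ).totalDegree :=
              MvPolynomial.totalDegree_mul _ _
          _ ≤ 0 + 1 := Nat.add_le_add (le_of_eq (MvPolynomial.totalDegree_C _))
              (MvPolynomial.totalDegree_X k).le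
          _ = 1 := rfl
      · rw [hK2 _ (hK1 _ _ hu).1.2 hv, mul_one, MvPolynomial.totalDegree_C]
        exact Nat.zero_le _
    · rw [MvPolynomial.totalDegree_zero]
      exact Nat.zero_le _
  /- Schur complement through the idle block `B × B`, `B` = rows that are never tokens -/
  obtain ⟨p, hp⟩ : ∃ p : Fin m → Prop, ∀ i, p i ↔ ¬ ∃ k, a (i, τ₀ i) = MvPolynomial.X k :=
    ⟨_, fun _ => Iff.rfl⟩
  set S : Matrix {i // p i} {i // p i} ℂ := Matrix.of fun i i' => Sf i i' with hS
  have hSdet : S.det = ∏ i : {i // p i}, ((s ((i : Fin m), τ₀ i) : ℤ) : ℂ) :=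
    det_idleBlock_eq_prod E a ha hper s τ₀ hτ₀ p (fun i hi => (hp i).1 hi)
      (fun i i' hi _ hu => (hK1 _ _ hu).2 ((hp i).1 hi)) S
      (fun i i' => by rw [hS, Matrix.of_apply, hSf])
  have hSne : S.det ≠ 0 := by
    rw [hSdet]
    exact Finset.prod_ne_zero_iff.2 fun i _ => hunit _
  have hstep := det_eq_C_mul_det_schur M₁ p S hSne
    (fun i j => by rw [hS, Matrix.of_apply]; exact hZrow i j ((hp _).1 i.2))
  set L : Matrix {i // ¬ p i} {i // ¬ p i} (MvPolynomial (Fin (n + 3) × Fin (n + 3)) ℂ) :=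
    Matrix.of fun (i j : {i // ¬ p i}) => M₁ i j -
      ∑ l : {i // p i}, ∑ k : {i // p i}, M₁ i k * MvPolynomial.C (S⁻¹ k l) * M₁ l j with hL
  have hLdeg : ∀ i j, (L i j).totalDegree ≤ 1 := fun i j => by
    rw [hL, Matrix.of_apply]
    exact totalDegree_schur_le M₁ p S⁻¹ 1 0 (by norm_num) hdeg (fun i k => hdeg i k)
      (fun l j => le_of_eq (by rw [hZrow l j ((hp _).1 l.2), MvPolynomial.totalDegree_C])) i j
  /- `per = C c · det L` with `c ≠ 0` -/
  set c : ℂ := ((Equiv.Perm.sign τ₀ : ℤ) : ℂ) * S.det with hc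
  have hcne : c ≠ 0 := by
    refine mul_ne_zero ?_ hSne
    rcases Int.units_eq_one_or (Equiv.Perm.sign τ₀) with h | h <;> simp [h]
  have hsignsq : ((Equiv.Perm.sign τ₀ : ℤ) : MvPolynomial (Fin (n + 3) × Fin (n + 3)) ℂ) *
      ((Equiv.Perm.sign τ₀ : ℤ) : MvPolynomial (Fin (n + 3) × Fin (n + 3)) ℂ) = 1 := by
    rw [← Int.cast_mul, ← Units.val_mul, Int.units_mul_self, Units.val_one, Int.cast_one]
  have hperL : Literature.Computability.AlgebraicComplexity.perPoly (Fin (n + 3)) ℂ =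
      MvPolynomial.C c * L.det := by
    have h1 : M.det = ((Equiv.Perm.sign τ₀ : ℤ) : MvPolynomial (Fin (n + 3) × Fin (n + 3)) ℂ) *
        M₁.det := by
      rw [hdet₁, ← mul_assoc, hsignsq, one_mul]
    rw [← hdetM, h1, hstep, hc, map_mul,
      ← map_intCast (MvPolynomial.C : ℂ →+* MvPolynomial (Fin (n + 3) × Fin (n + 3)) ℂ)]
    ring
  /- the token rows of `τ₀` number `n + 3`: reindex and scale a row -/
  have hcardA : Fintype.card {i // ¬ p i} = n + 3 := by
    have h1 : (univ.filter fun i : Fin m => ¬ p i) =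
        univ.filter fun i : Fin m => ∃ k, a (i, τ₀ i) = MvPolynomial.X k :=
      Finset.filter_congr fun i _ => by rw [hp, not_not]
    rw [Fintype.card_subtype, h1, card_var_eq E a ha hper τ₀ hτ₀]
  have e₄ : {i // ¬ p i} ≃ Fin (n + 3) := Fintype.equivFinOfCardEq hcardA
  set F₀ : Matrix (Fin (n + 3)) (Fin (n + 3)) (MvPolynomial (Fin (n + 3) × Fin (n + 3)) ℂ) :=
    L.submatrix e₄.symm e₄.symm with hF₀
  have hF₀det : F₀.det = L.det := Matrix.det_submatrix_equiv_self e₄.symm L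
  set F : Matrix (Fin (n + 3)) (Fin (n + 3)) (MvPolynomial (Fin (n + 3) × Fin (n + 3)) ℂ) :=
    F₀.updateRow 0 ((MvPolynomial.C c : MvPolynomial (Fin (n + 3) × Fin (n + 3)) ℂ) • F₀ 0) with hF
  have hFdet : F.det = MvPolynomial.C c * F₀.det := by
    rw [hF, Matrix.det_updateRow_smul, Matrix.updateRow_eq_self]
  have hFdeg : ∀ i j, (F i j).totalDegree ≤ 1 := by
    intro i j
    by_cases hi : i = 0
    · subst hi
      rw [hF, Matrix.updateRow_self, Pi.smul_apply, smul_eq_mul]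
      calc (MvPolynomial.C c * F₀ 0 j).totalDegree
          ≤ (MvPolynomial.C c : MvPolynomial (Fin (n + 3) × Fin (n + 3)) ℂ).totalDegree +
            (F₀ 0 j).totalDegree := MvPolynomial.totalDegree_mul _ _
        _ ≤ 0 + 1 := Nat.add_le_add (le_of_eq (MvPolynomial.totalDegree_C _))
            (by rw [hF₀, Matrix.submatrix_apply]; exact hLdeg _ _)
        _ = 1 := rfl
    · rw [hF, Matrix.updateRow_ne hi, hF₀, Matrix.submatrix_apply]
      exact hLdeg _ _
  have hrepr : HasDetRepr (Literature.Computability.AlgebraicComplexity.perPoly (Fin (n + 3)) ℂ)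
      (n + 3) :=
    ⟨F, fun i j => hFdeg i j, by rw [hFdet, hF₀det, ← hperL]⟩
  have hsq := sq_le_two_mul_of_hasDetRepr_perPoly hrepr
  nlinarith

end Summit.ValiantsHypothesis.ValiantsHypothesis.Theorems.PolyaContinuedMonotoneCoverHard
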